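import Mathlib
import Literature.Computability.AlgebraicComplexity.OrbitClosure
import Summits.ValiantsHypothesis.ValiantsHypothesis.Theorems.BorderApolarityFixedWitnessObstructionQPH0Elementary
import Summits.ValiantsHypothesis.ValiantsHypothesis.Theorems.BorderApolarityBorelFixedBorderApolarityWeightsA

/-!
# Border apolarity, support item `BorelFixedBorderApolarity` — a generic anti-dominant cocharacter of the torus of `H₀`

Route `ValiantsHypothesis/BorderApolarity`, support item `stmt-ValiantsHypothesis-5781`, helper
file (weights, part B): `bfba_exists_weight`.  For `1 ≤ n ≤ m` there is an integer weight `μ` on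
the `m²` variables `Fin m × Fin m` of the generic matrix (own variables: the padding variable
`(0,0)` and the block `{v | m-n ≤ v.1 ∧ m-n ≤ v.2}`; the others are "unused") such that

1. `μ ≥ 0`;
2. (anti-dominance) `μ a < μ b` whenever `a` is unused and `rk b < rk a` for the order `rk` of the
   route statement (own variables first, unused last, lexicographic inside) — the substitutions
   by unipotent elements of `H₀ᵀ` LOWER `μ`-weights;
3. the padded permanent `X₀₀^{m-n} per_n` is `μ`-weighted homogeneous (block weights are
   `α_i + β_j`), so the one-parameter torus `diag(c^μ)` fixes it up to a scalar;
4. (genericity) two exponents of degree `≤ m` with the same `μ`-weight have the same CONTENT (same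
   exponents off the block, same row and column sums on the block), hence the same character
   `∏_v d_v^{e_v}` for every nowhere-zero `d` with the rank-one pattern
   `d_{ij} d_{kl} = d_{il} d_{kj}` on the block — so `μ`-graded subspaces of forms are stable
   under the diagonal part of `H₀`;
5. weights of exponents of degree `≤ m` are bounded.

Construction: base `R = m + 2`, `μ_v = R^{m²+v.1} + R^{m²+m+v.2}` on the block,
`μ₀₀ = R^{m²+2m}`, and `μ_z = R^{m²-1-(z.1 m + z.2)}` for unused `z`; the weight of a monomial of
degree `≤ m` is then a base-`R` numeral whose digits are the content (`WeightsA`).  Folklore.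
-/

open MvPolynomial
open scoped BigOperators

namespace Summit.ValiantsHypothesis.ValiantsHypothesis.Theorems.BorderApolarityBorelFixedBorderApolarity

set_option linter.dupNamespace false

open Literature.Computability.AlgebraicComplexity
open Summit.ValiantsHypothesis.ValiantsHypothesis.Theorems.BorderApolarityFixedWitnessObstructionQP
  (fst_mul_add_snd_lt)

/-- **A generic anti-dominant cocharacter of the torus of `H₀(n,m)`** with the five properties of
the module docstring (nonnegativity, anti-dominance for the order `rk`, weighted homogeneity of
the padded permanent, content/character genericity in degrees `≤ m`, boundedness). [folklore] -/
theorem bfba_exists_weight (n m : ℕ) [NeZero m] (h1n : 1 ≤ n) (hnm : n ≤ m) :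
    ∃ μ : Fin m × Fin m → ℤ,
      (∀ v, 0 ≤ μ v) ∧
      (∀ a b : Fin m × Fin m, ¬ ((m - n ≤ (a.1 : ℕ) ∧ m - n ≤ (a.2 : ℕ)) ∨ a = (0, 0)) →
        (if (m - n ≤ (b.1 : ℕ) ∧ m - n ≤ (b.2 : ℕ)) ∨ b = (0, 0) then 0 else m * m) +
            ((b.1 : ℕ) * m + (b.2 : ℕ)) <
          (if (m - n ≤ (a.1 : ℕ) ∧ m - n ≤ (a.2 : ℕ)) ∨ a = (0, 0) then 0 else m * m) +
            ((a.1 : ℕ) * m + (a.2 : ℕ)) →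
        μ a < μ b) ∧
      (∃ ν₀ : ℤ, ∀ d ∈ (paddedPerPoly ℂ n m).support, Finsupp.weight μ d = ν₀) ∧
      (∀ e e' : Fin m × Fin m →₀ ℕ, e.degree ≤ m → e'.degree ≤ m →
        Finsupp.weight μ e = Finsupp.weight μ e' →
        ∀ d : Fin m × Fin m → ℂ, (∀ v, d v ≠ 0) →
          (∀ i k j l : Fin m, m - n ≤ (i : ℕ) → m - n ≤ (k : ℕ) → m - n ≤ (j : ℕ) →
            m - n ≤ (l : ℕ) → d (i, j) * d (k, l) = d (i, l) * d (k, j)) →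
          ∏ v ∈ e.support, d v ^ e v = ∏ v ∈ e'.support, d v ^ e' v) ∧
      (∃ hi : ℤ, ∀ e : Fin m × Fin m →₀ ℕ, e.degree ≤ m → Finsupp.weight μ e ≤ hi) := by
  classical
  have hm : 1 ≤ m := h1n.trans hnm
  -- notation
  set L : ℕ := m * m with hL
  set R : ℕ := m + 2 with hR
  have hR1 : 1 < R := by omega
  have hR0 : 0 < R := by omega
  have hL1 : m ≤ L := by rw [hL]; exact Nat.le_mul_of_pos_right m hm
  set blk : Fin m × Fin m → Prop := fun v => m - n ≤ (v.1 : ℕ) ∧ m - n ≤ (v.2 : ℕ) with hblk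
  set lin : Fin m × Fin m → ℕ := fun v => (v.1 : ℕ) * m + (v.2 : ℕ) with hlin
  have hlinL : ∀ v, lin v < L := fun v => fst_mul_add_snd_lt v
  set g₁ : Fin m × Fin m → ℕ := fun v =>
    if blk v then L + (v.1 : ℕ) else if v = (0, 0) then L + 2 * m else L - 1 - lin v with hg₁
  set g₂ : Fin m × Fin m → ℕ := fun v => L + m + (v.2 : ℕ) with hg₂
  set μn : Fin m × Fin m → ℕ := fun v => R ^ g₁ v + if blk v then R ^ g₂ v else 0 with hμn
  set Q : ℕ := L + 2 * m + 1 with hQ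
  have hg₁Q : ∀ v, g₁ v < Q := by
    intro v
    simp only [hg₁]
    have := v.1.isLt
    have := hlinL v
    split_ifs <;> omega
  have hg₂Q : ∀ v, blk v → g₂ v < Q := by
    intro v _
    simp only [hg₂]
    have := v.2.isLt
    omega
  have hg₁₂ : ∀ v, blk v → g₁ v ≠ g₂ v := by
    intro v hv
    simp only [hg₁, hg₂, if_pos hv]
    have := v.1.isLt
    omega
  -- the digits of an exponent
  set dig : ℕ → (Fin m × Fin m → ℕ) → ℕ := fun q e =>
    (∑ v ∈ Finset.univ.filter (fun v => g₁ v = q), e v) +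
      ∑ v ∈ Finset.univ.filter (fun v => blk v ∧ g₂ v = q), e v with hdig
  have hweight : ∀ e : Fin m × Fin m →₀ ℕ,
      Finsupp.weight (fun v => (μn v : ℤ)) e = ((∑ q ∈ Finset.range Q, dig q e * R ^ q : ℕ) : ℤ) := by
    intro e
    rw [bfba_weight_natCast, bfba_weight_eq_digitSum g₁ g₂ blk R Q hg₁Q hg₂Q]
  have hdiglt : ∀ e : Fin m × Fin m →₀ ℕ, e.degree ≤ m → ∀ q, dig q e < R := by
    intro e he q
    have h1 := bfba_digit_le g₁ g₂ blk hg₁₂ e q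
    rw [bfba_sum_eq_degree] at h1
    simp only [hdig]
    omega
  refine ⟨fun v => (μn v : ℤ), fun v => Int.natCast_nonneg _, ?_, ?_, ?_, ?_⟩
  · -- anti-dominance
    intro a b ha hlt
    rw [if_neg ha] at hlt
    have ha' : ¬ blk a ∧ a ≠ (0, 0) := not_or.1 ha
    have hμa : μn a = R ^ (L - 1 - lin a) := by
      simp only [hμn, hg₁, if_neg ha'.1, if_neg ha'.2, add_zero]
    have hla := hlinL a
    suffices h : μn a < μn b by
      show (μn a : ℤ) < (μn b : ℤ)
      exact_mod_cast h
    rw [hμa]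
    by_cases hb : blk b
    · have h1 : R ^ (L - 1 - lin a) < R ^ (L + (b.1 : ℕ)) := Nat.pow_lt_pow_right hR1 (by omega)
      have h2 : R ^ (L + (b.1 : ℕ)) ≤ μn b := by
        simp only [hμn, hg₁, if_pos hb]
        exact Nat.le_add_right _ _
      exact lt_of_lt_of_le h1 h2
    · by_cases hb0 : b = (0, 0)
      · have h2 : μn b = R ^ (L + 2 * m) := by
          simp only [hμn, hg₁, if_neg hb, if_pos hb0, add_zero]
        rw [h2]
        exact Nat.pow_lt_pow_right hR1 (by omega)
      · have h2 : μn b = R ^ (L - 1 - lin b) := by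
          simp only [hμn, hg₁, if_neg hb, if_neg hb0, add_zero]
        have hb' : ¬ (blk b ∨ b = (0, 0)) := by
          rintro (h | h)
          · exact hb h
          · exact hb0 h
        rw [if_neg hb'] at hlt
        rw [h2]
        have hlb := hlinL b
        refine Nat.pow_lt_pow_right hR1 ?_
        simp only [hlin] at hla hlb hlt ⊢
        omega
  · -- the padded permanent is weighted homogeneous
    have hblkB : ∀ b b' : BlockIdx n m, blk ((b : Fin m), (b' : Fin m)) := fun b b' => ⟨b.2, b'.2⟩
    set WB : ℤ := ∑ b : BlockIdx n m,
      (((R ^ (L + ((b : Fin m) : ℕ)) : ℕ) : ℤ) + (((R ^ (L + m + ((b : Fin m) : ℕ))) : ℕ) : ℤ)) with hWB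
    refine ⟨(m - n) • ((μn (0, 0) : ℕ) : ℤ) + WB, ?_⟩
    intro dd hdd
    have hterm : ∀ π : Equiv.Perm (BlockIdx n m),
        IsWeightedHomogeneous (fun v => (μn v : ℤ))
          (∏ i : BlockIdx n m, (X (((π i : BlockIdx n m) : Fin m), ((i : BlockIdx n m) : Fin m)) :
            MvPolynomial (Fin m × Fin m) ℂ)) WB := by
      intro π
      have h := IsWeightedHomogeneous.prod (w := fun v => (μn v : ℤ)) Finset.univ
        (fun i : BlockIdx n m => (X (((π i : BlockIdx n m) : Fin m), ((i : BlockIdx n m) : Fin m)) :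
          MvPolynomial (Fin m × Fin m) ℂ))
        (fun i => (μn (((π i : BlockIdx n m) : Fin m), ((i : BlockIdx n m) : Fin m)) : ℤ))
        (fun i _ => isWeightedHomogeneous_X _ _ _)
      have hsum : ∑ i : BlockIdx n m, (μn (((π i : BlockIdx n m) : Fin m), ((i : BlockIdx n m) : Fin m)) : ℤ) = WB := by
        have h1 : ∀ i : BlockIdx n m, (μn (((π i : BlockIdx n m) : Fin m), ((i : BlockIdx n m) : Fin m)) : ℤ) =
            (((R ^ (L + (((π i : BlockIdx n m) : Fin m) : ℕ)) : ℕ) : ℤ) +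
              (((R ^ (L + m + (((i : BlockIdx n m) : Fin m) : ℕ))) : ℕ) : ℤ)) := by
          intro i
          simp only [hμn, hg₁, hg₂, if_pos (hblkB (π i) i)]
          push_cast
          ring
        simp only [h1, Finset.sum_add_distrib, hWB]
        congr 1
        exact Equiv.sum_comp π (fun b : BlockIdx n m => (((R ^ (L + ((b : Fin m) : ℕ)) : ℕ) : ℤ)))
      rwa [hsum] at h
    have hhom : IsWeightedHomogeneous (fun v => (μn v : ℤ)) (paddedPerPoly ℂ n m)
        ((m - n) • ((μn (0, 0) : ℕ) : ℤ) + WB) := by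
      unfold paddedPerPoly
      refine IsWeightedHomogeneous.mul ((isWeightedHomogeneous_X _ _ _).pow (m - n)) ?_
      rw [perPoly, Matrix.permanent, map_sum]
      refine IsWeightedHomogeneous.sum _ _ _ fun π _ => ?_
      rw [map_prod]
      simp only [Matrix.mvPolynomialX_apply, rename_X]
      exact hterm π
    exact hhom (mem_support_iff.1 hdd)
  · -- genericity: equal weights in degree ≤ m ⇒ equal content ⇒ equal characters
    intro e e' he he' hw d hd hpat
    -- the digits agree
    have hdigeq : ∀ q, q < Q → dig q e = dig q e' := by
      refine bfba_digits_inj R hR0 Q (fun q => dig q e) (fun q => dig q e') (hdiglt e he)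
        (hdiglt e' he') ?_
      have h := hw
      rw [hweight e, hweight e'] at h
      exact_mod_cast h
    -- (i) off-block variables other than `(0,0)`
    have hoff1 : ∀ v, ¬ blk v → v ≠ (0, 0) → e v = e' v := by
      intro v hv hv0
      have hlv := hlinL v
      have hq : L - 1 - lin v < Q := by omega
      have key : ∀ f : Fin m × Fin m →₀ ℕ, dig (L - 1 - lin v) f = f v := by
        intro f
        have hfil1 : Finset.univ.filter (fun u => g₁ u = L - 1 - lin v) = {v} := by
          refine Finset.eq_singleton_iff_unique_mem.2 ⟨?_, ?_⟩
          · rw [Finset.mem_filter]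
            refine ⟨Finset.mem_univ _, ?_⟩
            simp only [hg₁, if_neg hv, if_neg hv0]
          · intro u hu
            have hu' := (Finset.mem_filter.1 hu).2
            simp only [hg₁] at hu'
            have hlu := hlinL u
            have := u.1.isLt
            split_ifs at hu' with hb hu0
            · omega
            · omega
            · apply bfba_lin_injective
              simp only [hlin] at hu' hlu hlv ⊢
              omega
        have hfil2 : Finset.univ.filter (fun u => blk u ∧ g₂ u = L - 1 - lin v) = ∅ := by
          refine Finset.filter_eq_empty_iff.2 fun u _ hu => ?_
          simp only [hg₂] at hu
          omega
        simp only [hdig]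
        rw [hfil1, hfil2, Finset.sum_singleton, Finset.sum_empty, add_zero]
      have h := hdigeq _ hq
      rwa [key e, key e'] at h
    -- (ii) the padding variable, when off the block
    have hoff0 : ¬ blk (0, 0) → e (0, 0) = e' (0, 0) := by
      intro hb0
      have hq : L + 2 * m < Q := by omega
      have key : ∀ f : Fin m × Fin m →₀ ℕ, dig (L + 2 * m) f = f (0, 0) := by
        intro f
        have hfil1 : Finset.univ.filter (fun u => g₁ u = L + 2 * m) = {(0, 0)} := by
          refine Finset.eq_singleton_iff_unique_mem.2 ⟨?_, ?_⟩
          · rw [Finset.mem_filter]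
            refine ⟨Finset.mem_univ _, ?_⟩
            simp only [hg₁, if_neg hb0, if_true]
          · intro u hu
            have hu' := (Finset.mem_filter.1 hu).2
            simp only [hg₁] at hu'
            have hlu := hlinL u
            have := u.1.isLt
            split_ifs at hu' with hb hu0
            · omega
            · exact hu0
            · omega
        have hfil2 : Finset.univ.filter (fun u => blk u ∧ g₂ u = L + 2 * m) = ∅ := by
          refine Finset.filter_eq_empty_iff.2 fun u _ hu => ?_
          simp only [hg₂] at hu
          have := u.2.isLt
          omega
        simp only [hdig]
        rw [hfil1, hfil2, Finset.sum_singleton, Finset.sum_empty, add_zero]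
      have h := hdigeq _ hq
      rwa [key e, key e'] at h
    have hoff : ∀ v, ¬ blk v → e v = e' v := by
      intro v hv
      by_cases hv0 : v = (0, 0)
      · subst hv0; exact hoff0 hv
      · exact hoff1 v hv hv0
    -- (iii) row sums on the block
    have hrow : ∀ i : Fin m, ∑ u ∈ Finset.univ.filter (fun u => blk u ∧ u.1 = i), e u =
        ∑ u ∈ Finset.univ.filter (fun u => blk u ∧ u.1 = i), e' u := by
      intro i
      have hi := i.isLt
      have hq : L + (i : ℕ) < Q := by omega
      have key : ∀ f : Fin m × Fin m →₀ ℕ,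
          dig (L + (i : ℕ)) f = ∑ u ∈ Finset.univ.filter (fun u => blk u ∧ u.1 = i), f u := by
        intro f
        have hfil1 : Finset.univ.filter (fun u => g₁ u = L + (i : ℕ)) =
            Finset.univ.filter (fun u => blk u ∧ u.1 = i) := by
          refine Finset.filter_congr fun u _ => ?_
          simp only [hg₁]
          have hlu := hlinL u
          have := u.1.isLt
          split_ifs with hb hu0
          · rw [Fin.ext_iff]
            constructor
            · intro h; exact ⟨hb, by omega⟩
            · intro h; omega
          · constructor
            · intro h; omega
            · intro h; exact absurd h.1 hb
          · constructor
            · intro h; omega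
            · intro h; exact absurd h.1 hb
        have hfil2 : Finset.univ.filter (fun u => blk u ∧ g₂ u = L + (i : ℕ)) = ∅ := by
          refine Finset.filter_eq_empty_iff.2 fun u _ hu => ?_
          simp only [hg₂] at hu
          omega
        simp only [hdig]
        rw [hfil1, hfil2, Finset.sum_empty, add_zero]
      have h := hdigeq _ hq
      rwa [key e, key e'] at h
    -- (iv) column sums on the block
    have hcol : ∀ j : Fin m, ∑ u ∈ Finset.univ.filter (fun u => blk u ∧ u.2 = j), e u =
        ∑ u ∈ Finset.univ.filter (fun u => blk u ∧ u.2 = j), e' u := by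
      intro j
      have hj := j.isLt
      have hq : L + m + (j : ℕ) < Q := by omega
      have key : ∀ f : Fin m × Fin m →₀ ℕ,
          dig (L + m + (j : ℕ)) f = ∑ u ∈ Finset.univ.filter (fun u => blk u ∧ u.2 = j), f u := by
        intro f
        have hfil1 : Finset.univ.filter (fun u => g₁ u = L + m + (j : ℕ)) = ∅ := by
          refine Finset.filter_eq_empty_iff.2 fun u _ hu => ?_
          simp only [hg₁] at hu
          have hlu := hlinL u
          have := u.1.isLt
          split_ifs at hu <;> omega
        have hfil2 : Finset.univ.filter (fun u => blk u ∧ g₂ u = L + m + (j : ℕ)) =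
            Finset.univ.filter (fun u => blk u ∧ u.2 = j) := by
          refine Finset.filter_congr fun u _ => ?_
          simp only [hg₂]
          rw [Fin.ext_iff]
          constructor
          · rintro ⟨hb, h⟩; exact ⟨hb, by omega⟩
          · rintro ⟨hb, h⟩; exact ⟨hb, by omega⟩
        simp only [hdig]
        rw [hfil1, hfil2, Finset.sum_empty, zero_add]
      have h := hdigeq _ hq
      rwa [key e, key e'] at h
    -- the characters: products over all variables, split along the block
    have hprod : ∀ f : Fin m × Fin m →₀ ℕ, ∏ v ∈ f.support, d v ^ f v = ∏ v, d v ^ f v := fun f =>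
      Finset.prod_subset (Finset.subset_univ _) fun v _ hv => by
        rw [Finsupp.notMem_support_iff.1 hv, pow_zero]
    rw [hprod e, hprod e', ← Finset.prod_filter_mul_prod_filter_not Finset.univ blk,
      ← Finset.prod_filter_mul_prod_filter_not Finset.univ blk (fun v => d v ^ e' v)]
    -- the rank-one pattern: `d_{ij} = a_i b_j` on the block
    set i₀ : Fin m := ⟨m - 1, by omega⟩ with hi₀
    have hi₀b : m - n ≤ ((i₀ : Fin m) : ℕ) := by simp only [hi₀]; omega
    have hfac : ∀ v, blk v → d v = d (v.1, i₀) * (d (i₀, v.2) / d (i₀, i₀)) := by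
      intro v hv
      have h := hpat v.1 i₀ v.2 i₀ hv.1 hi₀b hv.2 hi₀b
      have h0 := hd (i₀, i₀)
      rw [mul_div_assoc', eq_div_iff h0, ← h]
    have hrowprod : ∀ (f : Fin m × Fin m →₀ ℕ) (c : Fin m → ℂ),
        ∏ v ∈ Finset.univ.filter blk, c v.1 ^ f v =
          ∏ i : Fin m, c i ^ ∑ u ∈ Finset.univ.filter (fun u => blk u ∧ u.1 = i), f u := by
      intro f c
      rw [← Finset.prod_fiberwise_of_maps_to (s := Finset.univ.filter blk) (t := Finset.univ)
        (g := Prod.fst) (fun v _ => Finset.mem_univ _)]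
      refine Finset.prod_congr rfl fun i _ => ?_
      rw [Finset.filter_filter]
      have hc : ∀ v ∈ Finset.univ.filter (fun v => blk v ∧ v.1 = i), c v.1 ^ f v = c i ^ f v :=
        fun v hv => by rw [(Finset.mem_filter.1 hv).2.2]
      rw [Finset.prod_congr rfl hc, Finset.prod_pow_eq_pow_sum]
    have hcolprod : ∀ (f : Fin m × Fin m →₀ ℕ) (c : Fin m → ℂ),
        ∏ v ∈ Finset.univ.filter blk, c v.2 ^ f v =
          ∏ j : Fin m, c j ^ ∑ u ∈ Finset.univ.filter (fun u => blk u ∧ u.2 = j), f u := by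
      intro f c
      rw [← Finset.prod_fiberwise_of_maps_to (s := Finset.univ.filter blk) (t := Finset.univ)
        (g := Prod.snd) (fun v _ => Finset.mem_univ _)]
      refine Finset.prod_congr rfl fun j _ => ?_
      rw [Finset.filter_filter]
      have hc : ∀ v ∈ Finset.univ.filter (fun v => blk v ∧ v.2 = j), c v.2 ^ f v = c j ^ f v :=
        fun v hv => by rw [(Finset.mem_filter.1 hv).2.2]
      rw [Finset.prod_congr rfl hc, Finset.prod_pow_eq_pow_sum]
    have hblock : ∀ f : Fin m × Fin m →₀ ℕ, ∏ v ∈ Finset.univ.filter blk, d v ^ f v =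
        (∏ i : Fin m, d (i, i₀) ^ ∑ u ∈ Finset.univ.filter (fun u => blk u ∧ u.1 = i), f u) *
          ∏ j : Fin m, (d (i₀, j) / d (i₀, i₀)) ^
            ∑ u ∈ Finset.univ.filter (fun u => blk u ∧ u.2 = j), f u := by
      intro f
      rw [← hrowprod f (fun i => d (i, i₀)), ← hcolprod f (fun j => d (i₀, j) / d (i₀, i₀)),
        ← Finset.prod_mul_distrib]
      refine Finset.prod_congr rfl fun v hv => ?_
      rw [← mul_pow, ← hfac v (Finset.mem_filter.1 hv).2]
    congr 1
    · rw [hblock e, hblock e']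
      simp only [hrow, hcol]
    · exact Finset.prod_congr rfl fun v hv => by rw [hoff v (Finset.mem_filter.1 hv).2]
  · -- boundedness
    refine ⟨(m : ℤ) * ∑ v, (μn v : ℤ), fun e he => ?_⟩
    rw [bfba_weight_natCast]
    have h1 : ∑ v, e v * μn v ≤ ∑ v, e v * ∑ u, μn u := by
      refine Finset.sum_le_sum fun v _ => Nat.mul_le_mul_left _ ?_
      exact Finset.single_le_sum (fun u _ => Nat.zero_le (μn u)) (Finset.mem_univ v)
    rw [← Finset.sum_mul, bfba_sum_eq_degree] at h1
    have h2 : e.degree * ∑ u, μn u ≤ m * ∑ u, μn u := Nat.mul_le_mul_right _ he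
    have h3 := h1.trans h2
    exact_mod_cast h3

end Summit.ValiantsHypothesis.ValiantsHypothesis.Theorems.BorderApolarityBorelFixedBorderApolarity
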